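import Summits.BirchSwinnertonDyer.BirchSwinnertonDyer.Theorems.ClassRecordThreeCornerAtThreeShimuraFamilySupplyFromLabels
import Summits.BirchSwinnertonDyer.Rank1Residual.X11b.RingClassFieldConj
import Summits.BirchSwinnertonDyer.Rank1Residual.X11b.RingClassFieldNoTorsionOfIrreducible
import HarnessLib

/-!
# STANDING INPUTS for a GENERALISED Kolyvagin datum `d : JET.KolyvaginFamilyData W K ι n`: `Γ_K`-equivariance of `E(K[n]) → E(K̄)`,
# ADMISSIBILITY of `d.pointsSubgroup` for `p^M` (`ρ̄` onto, or `E[p]` irreducible), and STABILITY under lifts of `Aut(K/ℚ)` —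
# the producers `hA` ∕ `hAτ` of this seat's (P2) assembly `Koly.familyLevelSupply_of_memberships`
# (cell `bsd-stepL`, seat `bsd-stepL-tam3-p1` g13, owner of 19109's line; `--supports stmt-BirchSwinnertonDyer-19109 --as helper`)

HONEST FRAMING. Family twins (proofs VERBATIM — the datum enters through `emb`, `emb_apply`, `toGeomPoints` only) of x11b3's
`RingClassNoTorsion.isAdmissible_pointsSubgroup`, `NoTorsionIrr.isAdmissible_pointsSubgroup_of_hasIrreducibleModPGaloisRep`,
`RingClassConj.exists_algEquiv_apply_emb_eq` ∕ `pointsMap_toGeomPoints_eq` ∕ `pointsMap_mem_pointsSubgroup` for the GENERALISED datum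
(RULING 46 (P0′): `KolyvaginHeegnerData ↦ KolyvaginFamilyData`); the two admissibility theorems are 1-line corollaries of corner3-p2 g8's
`ShimuraWalk.isAdmissible_pointsSubgroup_familyData` (`…ShimuraFamilySupplyFromLabels`, `htor` form — imported, not redone) with `htor`
DISCHARGED by x11b3's `eq_zero_of_zsmul_pow_eq_zero_ringClassField` (`ρ̄` onto) ∕ `torsionBy_pow_ringClassField_eq_bot_of_hasIrreducibleModPGaloisRep`
(`E[p]` irreducible). THEOREMS ONLY (no definition, no named fact, no `sorry`); nothing about any CM ∕ Heegner point; no stub closes; 0 classes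
move (T7); BSD is not proved by any of this. Credit: x11b3 (p3, p8), corner3-p2 g8.
WHY. The (P2) assembly (`…KolyvaginFamilyLevelSupply`) asks, for EVERY datum `d` of the labelled family, the admissibility of
`A = d.pointsSubgroup = E(emb)(E(K[n]))` at every depth (`hA`) and its stability under a lift of complex conjugation (`hAτ`); these depend on
`d` only through the embedding `d.emb : K[n] → K̄` and hold for every datum: `isAdmissible_pointsSubgroup_family` (`ρ̄_{E,p}` onto — the
19109 slice), `isAdmissible_pointsSubgroup_family_of_hasIrreducibleModPGaloisRep` (`E[p]` irreducible with the Weil pairing, `p` unramified in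
`K`, `p ∤ n` — the 21420 corner), `pointsMap_mem_pointsSubgroup_family` (any lift of any `c ∈ Aut(K/ℚ)`).
References (locators only): [cite: GrossLMS1991, §4 (4.2), Lemma 4.3, §5] [cite: McCallumLMS1991, §4 (5)] [cite: Cox2013, §9.A Lemma 9.3].
presearch: not applicable (re-keying of tree theorems); `lean search 'isAdmissible_pointsSubgroup_family'` → none.
Design: theorems only; `K : Type`. Axioms: `propext`, `Classical.choice`, `Quot.sound`.
-/

set_option autoImplicit false

noncomputable section

open scoped Classical

namespace Summit.BirchSwinnertonDyer.Rank1Residual.JET.KolyvaginFamilyData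

open Field WeierstrassCurve NumberField IsDedekindDomain
  Literature.NumberTheory.EllipticCurves Literature.NumberTheory.GaloisRepresentations
  Literature.NumberTheory.EllipticCurves.KolyvaginCocycle
  Summit.BirchSwinnertonDyer.Rank1Residual.X11b Summit.BirchSwinnertonDyer.BirchSwinnertonDyer.Theorems

variable {K : Type} [Field K] [NumberField K] {W : WeierstrassCurve ℚ} {ι : K →+* ℂ} {n : ℕ}
  (d : KolyvaginFamilyData W K ι n)

/-! ### §1 Admissibility of `E(K[n]) ⊆ E(K̄)` (the producer `hA`) -/

/-- **`hA` for a family datum, `ρ̄_{E,p}` onto**: `d.pointsSubgroup` is `Γ_K`-stable and `p^M`-torsion-free for every `M` (corner3-p2's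
`htor`-form `ShimuraWalk.isAdmissible_pointsSubgroup_familyData`, `htor` discharged by `eq_zero_of_zsmul_pow_eq_zero_ringClassField`). Twin of
`RingClassNoTorsion.isAdmissible_pointsSubgroup`. [cite: McCallumLMS1991, §4 (5)] [cite: GrossLMS1991, §4, Lemma 4.3 and (4.2)] -/
theorem isAdmissible_pointsSubgroup_family [W.IsElliptic] (hK : IsImaginaryQuadratic K) (hn : n ≠ 0) {p : ℕ}
    (hp : p.Prime) (hp2 : p ≠ 2) (hρ : W.HasSurjectiveModNGaloisRep p) (M : ℕ) :
    IsAdmissible (absoluteGaloisGroup K) d.pointsSubgroup ((p ^ M : ℕ) : ℤ) :=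
  ShimuraWalk.isAdmissible_pointsSubgroup_familyData hK d fun n' a ha ↦
    RingClassNoTorsion.eq_zero_of_zsmul_pow_eq_zero_ringClassField W hK ι hn hp hp2 hρ n' a ha

/-- **`hA` for a family datum, `E[p]` IRREDUCIBLE** (with the Weil pairing, `p` unramified in `K`, `p ∤ n`; `htor` discharged by
`torsionBy_pow_ringClassField_eq_bot_of_hasIrreducibleModPGaloisRep`): twin of `NoTorsionIrr.isAdmissible_pointsSubgroup_of_hasIrreducibleModPGaloisRep`.
[cite: McCallumLMS1991, §4 (5)] [cite: GrossLMS1991, §4, Lemma 4.3] -/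
theorem isAdmissible_pointsSubgroup_family_of_hasIrreducibleModPGaloisRep [W.IsElliptic]
    (hK : IsImaginaryQuadratic K) (hn : n ≠ 0) {p : ℕ} (hp : p.Prime) (hp2 : p ≠ 2)
    (hirr : W.HasIrreducibleModPGaloisRep p) (hW : W.exists_weilPairing p)
    (hKunr : ∀ v : HeightOneSpectrum (𝓞 ℚ), (p : 𝓞 ℚ) ∈ v.asIdeal →
      Algebra.IsUnramifiedIn (𝓞 K) v.asIdeal)
    (hpn : ¬ p ∣ n) (M : ℕ) :
    IsAdmissible (absoluteGaloisGroup K) d.pointsSubgroup ((p ^ M : ℕ) : ℤ) := by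
  refine ShimuraWalk.isAdmissible_pointsSubgroup_familyData hK d fun n' a ha ↦ ?_
  have h : a ∈ AddSubgroup.torsionBy (W.baseChange (ringClassField K ι n)).toAffine.Point
      ((p ^ n' : ℕ) : ℤ) := (Submodule.mem_torsionBy_iff ((p ^ n' : ℕ) : ℤ) a).mpr ha
  rwa [NoTorsionIrr.torsionBy_pow_ringClassField_eq_bot_of_hasIrreducibleModPGaloisRep W hK ι hn hp hp2 hirr hW
    hKunr hpn n', AddSubgroup.mem_bot] at h

/-! ### §2 Stability under lifts of `Aut(K/ℚ)` (the producer `hAτ`) -/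

/-- **A ring automorphism of `K̄` restricts along `d.emb` to an automorphism of `K[n]`** (`n ≠ 0`). Twin of
`RingClassConj.exists_algEquiv_apply_emb_eq`. [cite: Cox2013, §9.A Lemma 9.3] -/
theorem exists_algEquiv_apply_emb_eq_family (hK : IsImaginaryQuadratic K) (hn : n ≠ 0)
    (φ : AlgebraicClosure K ≃+* AlgebraicClosure K) :
    ∃ g : ringClassField K ι n ≃ₐ[ℚ] ringClassField K ι n, ∀ x, φ (d.emb x) = d.emb (g x) :=
  RingClassConj.exists_algEquiv_forall_apply_eq hK ι hn d.emb (φ.toRingHom.comp d.emb)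

/-- **Coordinatewise transport** along a lift `τ` of `c ∈ Aut(K/ℚ)` that restricts to `g ∈ Aut_ℚ(K[n])` on `d.emb`. Twin of
`RingClassConj.pointsMap_toGeomPoints_eq`. [folklore] -/
theorem pointsMap_toGeomPoints_eq_family {c : K ≃ₐ[ℚ] K}
    {τ : AlgebraicClosure K ≃+* AlgebraicClosure K} (hτ : IsLiftOfAut c τ)
    {g : ringClassField K ι n ≃ₐ[ℚ] ringClassField K ι n} (h : ∀ x, τ (d.emb x) = d.emb (g x))
    (P : (W.baseChange (ringClassField K ι n)).toAffine.Point) :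
    hτ.pointsMap W (d.toGeomPoints P) =
      d.toGeomPoints (pointGalHom W (ringClassField K ι n) g P) := by
  rcases P with _ | ⟨x, y, hxy⟩
  · change hτ.pointsMap W (d.toGeomPoints 0) =
      d.toGeomPoints (pointGalHom W (ringClassField K ι n) g 0)
    rw [map_zero, map_zero, map_zero, map_zero]
  · exact Affine.Point.some_eq_some_of_eq (h x) (h y)

/-- **`hAτ` for a family datum**: `d.pointsSubgroup = E(K[n]) ⊆ E(K̄)` is stable under EVERY lift `τ` of an automorphism `c` of `K`
(`K[n]/ℚ` is Galois). Twin of `RingClassConj.pointsMap_mem_pointsSubgroup`. [cite: GrossLMS1991, §5] [cite: Cox2013, §9.A Lemma 9.3] -/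
theorem pointsMap_mem_pointsSubgroup_family (hK : IsImaginaryQuadratic K) (hn : n ≠ 0) {c : K ≃ₐ[ℚ] K}
    {τ : AlgebraicClosure K ≃+* AlgebraicClosure K} (hτ : IsLiftOfAut c τ) :
    ∀ a ∈ d.pointsSubgroup, hτ.pointsMap W a ∈ d.pointsSubgroup := by
  obtain ⟨g, hg⟩ := d.exists_algEquiv_apply_emb_eq_family hK hn τ
  rintro _ ⟨P, rfl⟩
  exact ⟨pointGalHom W (ringClassField K ι n) g P, (d.pointsMap_toGeomPoints_eq_family hτ hg P).symm⟩

end Summit.BirchSwinnertonDyer.Rank1Residual.JET.KolyvaginFamilyData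

end
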